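import Summits.QuantumFields.YangMills.Theorems.AllWindowsColdBoxBoxHighLineTwoFormGaussDet
import Summits.QuantumFields.YangMills.Theorems.AllWindowsColdBoxBoxHighLineBoxQuadFormFloor
import Summits.QuantumFields.YangMills.Theorems.AllWindowsColdBoxBoxHighLineChartGaussianBulk

/-!
# Two-form Gaussian comparison, part 2: the chart Gaussians `e^{−β((1∓δ)Q ∓ δN)}` (U5-L5 (iii) T-S5.6′ `SmallFieldInsideFPSharp`,
# `Cruxes/BoxWindowHighSU2213/TaskU5L5.lean`; LINE-20 U5 ⟨stmt-QuantumFields-24336⟩; U5 prep, helper-grade; U5 OPEN)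

Width seat `ym-line-sfw-p2-w4` (prover-ym-line-sfw-p2-w4-g29-0), T-S5.6 lineage.  With `Q = boxQuadForm H`, `N(a) = Σ_e ‖a_e‖²` and the flat precisions
`P∓ = (2β)·((1 ∓ δ)·(hodgeQ ⊗ₖ 1₃) ∓ δ·1)` (so that `−β((1∓δ)Q(a) ∓ δN(a)) = −½ ♭aᵀ P∓ ♭a`), for `0 ≤ δ`, `1376·H²·δ ≤ 1` (= `δ ≤ κ/4` with the
Hodge–Poincaré coercivity `κ = (344H²)⁻¹` of ✓`BoxQuadForm.sum_norm_sq_le_boxQuadForm`) and a variance bound `(hodgeQ H)⁻¹ₑₑ ≤ C₃` (✓S3a):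

* `hodgeKron_coercive` — `|x|²/(344H²) ≤ xᵀ(hodgeQ ⊗ₖ 1₃)x`; `trace_hodgeKron_inv_le` — `tr (hodgeQ ⊗ₖ 1₃)⁻¹ ≤ 3C₃·n` (`n = |LandauFree H|`);
* `neg_twoFormMinus_eq` / `neg_twoFormPlus_eq` — the exponent identities; `posDef_precMinus` / `posDef_precPlus`;
* `integral_exp_twoFormMinus_le` — **the mass ratio** `∫ e^{−β((1−δ)Q − δN)} ≤ exp(((9 + 15C₃)/2)·δ·n) · ∫ e^{−β((1+δ)Q + δN)}` (part 1 ✓`det_twoForm_le`);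
* generic flat-precision tools `integral_eq_flat_of` / `setIntegral_compl_smallField_le_flat_of` / `setIntegral_compl_smallField_le_of` /
  `le_setIntegral_smallField_of` (any positive definite precision `P` with coordinate variances `P⁻¹_pp ≤ (2β′)⁻¹C₃`; w4 g27's ✓`ChartGauss` route made generic);
* `precMinus_inv_diag_le` / `precPlus_inv_diag_le` — coordinate variances `≤ C₃/β`, `≤ C₃/(2β)` (part 1 ✓`inv_diag_le_of_quadForm_le`);
* `setIntegral_compl_smallField_twoFormMinus_le` — **tail**: `∫_{a ∉ smallField s} e^{−β((1−δ)Q − δN)} ≤ 6n·e^{−(β/2)s²/(3C₃)} · ∫ e^{−β((1−δ)Q − δN)}`;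
* `le_setIntegral_smallField_twoFormPlus` — **box mass**: `(1 − 6n·e^{−βt²/(3C₃)}) · ∫ e^{−β((1+δ)Q + δN)} ≤ ∫_{smallField t} e^{−β((1+δ)Q + δN)}`.

Everything proved; no definitions; standard axioms.  HONEST LABEL: an input of the typed task T-S5.6′ (lift L5 of the NEXT rung U5); U5 ⟨24336⟩, ⟨24004⟩ and the
seat's own crux ⟨22884⟩ remain OPEN; nothing here closes a stub; **the Yang–Mills mass gap is NOT proved by this file; no summit is proved by a line.**
-/

set_option autoImplicit false

open MeasureTheory Matrix Finset Real
open scoped Kronecker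

namespace Summit.QuantumFields.YangMills.Theorems.AllWindowsColdBoxBoxHighLine

namespace TwoFormGauss

open LaplaceSandwich GaussianChartWick ChartGauss

variable {H : ℕ}

/-! ## The flat Hodge form: coercivity and trace of the inverse -/

/-- **Coercivity of the flat Hodge form**: `|x|²/(344H²) ≤ xᵀ(hodgeQ ⊗ₖ 1₃)x` (✓`sum_norm_sq_le_boxQuadForm` transported by `flatten`). -/
theorem hodgeKron_coercive (hH : 1 ≤ H) (x : LandauFree H × Fin 3 → ℝ) :
    1 / (344 * (H : ℝ) ^ 2) * (x ⬝ᵥ x) ≤ x ⬝ᵥ ((hodgeQ H ⊗ₖ (1 : Matrix (Fin 3) (Fin 3) ℝ)) *ᵥ x) := by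
  set a : LandauFree H → E3 := (flatten (LandauFree H)).symm x with ha
  have hx : flatten (LandauFree H) a = x := (flatten (LandauFree H)).apply_symm_apply x
  rw [← hx, ← boxQuadForm_eq_flat, ← sum_norm_sq_eq_dotProduct]
  have h := BoxQuadForm.sum_norm_sq_le_boxQuadForm hH a
  have hpos : (0 : ℝ) < 344 * (H : ℝ) ^ 2 := by positivity
  rw [one_div, inv_mul_le_iff₀ hpos]
  exact h

/-- **Trace of the inverse flat Hodge form**: `tr (hodgeQ ⊗ₖ 1₃)⁻¹ = 3·Σ_e (hodgeQ⁻¹)_{ee} ≤ 3·C₃·n`. -/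
theorem trace_hodgeKron_inv_le {C₃ : ℝ} (hvar : ∀ e : LandauFree H, (hodgeQ H)⁻¹ e e ≤ C₃) :
    ((hodgeQ H ⊗ₖ (1 : Matrix (Fin 3) (Fin 3) ℝ))⁻¹).trace ≤ 3 * C₃ * Fintype.card (LandauFree H) := by
  have hdet : (hodgeQ H).det ≠ 0 := (hodgeQ_posDef H).det_pos.ne'
  rw [kronecker_one_inv (hodgeQ H) hdet, Matrix.trace_kronecker, Matrix.trace_one, Fintype.card_fin]
  have h : (hodgeQ H)⁻¹.trace ≤ C₃ * Fintype.card (LandauFree H) := by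
    calc (hodgeQ H)⁻¹.trace = ∑ e, (hodgeQ H)⁻¹ e e := rfl
      _ ≤ ∑ _e : LandauFree H, C₃ := Finset.sum_le_sum fun e _ => hvar e
      _ = C₃ * Fintype.card (LandauFree H) := by rw [Finset.sum_const, Finset.card_univ, nsmul_eq_mul, mul_comm]
  push_cast
  nlinarith

/-! ## The two precisions -/

/-- The exponent identity for the MINUS form: `−β((1−δ)Q(a) − δN(a)) = −½ ♭aᵀ((2β)·((1−δ)(hodgeQ ⊗ₖ 1₃) − δ·1))♭a`. -/
theorem neg_twoFormMinus_eq (β δ : ℝ) (a : LandauFree H → E3) :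
    -(β * ((1 - δ) * boxQuadForm H a - δ * ∑ e, ‖a e‖ ^ 2)) =
      -(1/2 : ℝ) * (flatten (LandauFree H) a ⬝ᵥ
        (((2 * β) • ((1 - δ) • (hodgeQ H ⊗ₖ (1 : Matrix (Fin 3) (Fin 3) ℝ)) - δ • (1 : Matrix (LandauFree H × Fin 3) (LandauFree H × Fin 3) ℝ)))
          *ᵥ flatten (LandauFree H) a)) := by
  rw [boxQuadForm_eq_flat, sum_norm_sq_eq_dotProduct, Matrix.smul_mulVec, Matrix.sub_mulVec, Matrix.smul_mulVec, Matrix.smul_mulVec,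
    Matrix.one_mulVec, dotProduct_smul, dotProduct_sub, dotProduct_smul, dotProduct_smul]
  simp only [smul_eq_mul]
  ring

/-- The exponent identity for the PLUS form: `−β((1+δ)Q(a) + δN(a)) = −½ ♭aᵀ((2β)·((1+δ)(hodgeQ ⊗ₖ 1₃) + δ·1))♭a`. -/
theorem neg_twoFormPlus_eq (β δ : ℝ) (a : LandauFree H → E3) :
    -(β * ((1 + δ) * boxQuadForm H a + δ * ∑ e, ‖a e‖ ^ 2)) =
      -(1/2 : ℝ) * (flatten (LandauFree H) a ⬝ᵥ
        (((2 * β) • ((1 + δ) • (hodgeQ H ⊗ₖ (1 : Matrix (Fin 3) (Fin 3) ℝ)) + δ • (1 : Matrix (LandauFree H × Fin 3) (LandauFree H × Fin 3) ℝ)))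
          *ᵥ flatten (LandauFree H) a)) := by
  rw [boxQuadForm_eq_flat, sum_norm_sq_eq_dotProduct, Matrix.smul_mulVec, Matrix.add_mulVec, Matrix.smul_mulVec, Matrix.smul_mulVec,
    Matrix.one_mulVec, dotProduct_smul, dotProduct_add, dotProduct_smul, dotProduct_smul]
  simp only [smul_eq_mul]
  ring

/-- Hermitian-ness of the two (unscaled) forms. -/
theorem isHermitian_twoForm (c d : ℝ) :
    (c • (hodgeQ H ⊗ₖ (1 : Matrix (Fin 3) (Fin 3) ℝ)) + d • (1 : Matrix (LandauFree H × Fin 3) (LandauFree H × Fin 3) ℝ)).IsHermitian :=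
  ((posDef_kronecker_one (hodgeQ H) (hodgeQ_posDef H)).isHermitian.smul (IsSelfAdjoint.all c)).add
    (Matrix.isHermitian_one.smul (IsSelfAdjoint.all d))

/-- `(1−δ)A − δ·1 = (1−δ)•A + (−δ)•1` (bookkeeping). -/
theorem twoFormMinus_eq_add (δ : ℝ) :
    (1 - δ) • (hodgeQ H ⊗ₖ (1 : Matrix (Fin 3) (Fin 3) ℝ)) - δ • (1 : Matrix (LandauFree H × Fin 3) (LandauFree H × Fin 3) ℝ) =
      (1 - δ) • (hodgeQ H ⊗ₖ (1 : Matrix (Fin 3) (Fin 3) ℝ)) + (-δ) • (1 : Matrix (LandauFree H × Fin 3) (LandauFree H × Fin 3) ℝ) := by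
  rw [neg_smul, sub_eq_add_neg]

/-- **The MINUS form dominates half the Hodge form**: `xᵀ(hodgeQ ⊗ₖ 1₃)x ≤ 2·xᵀ((1−δ)(hodgeQ ⊗ₖ 1₃) − δ·1)x` when `1376·H²·δ ≤ 1`. -/
theorem quadForm_le_two_mul_minus (hH : 1 ≤ H) {δ : ℝ} (hδ0 : 0 ≤ δ) (hδ : 1376 * (H : ℝ) ^ 2 * δ ≤ 1) (x : LandauFree H × Fin 3 → ℝ) :
    x ⬝ᵥ ((hodgeQ H ⊗ₖ (1 : Matrix (Fin 3) (Fin 3) ℝ)) *ᵥ x) ≤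
      2 * (x ⬝ᵥ (((1 - δ) • (hodgeQ H ⊗ₖ (1 : Matrix (Fin 3) (Fin 3) ℝ)) -
        δ • (1 : Matrix (LandauFree H × Fin 3) (LandauFree H × Fin 3) ℝ)) *ᵥ x)) := by
  have hH' : (1 : ℝ) ≤ H := by exact_mod_cast hH
  have hH2 : (1 : ℝ) ≤ (H : ℝ) ^ 2 := one_le_pow₀ hH'
  have hκ : 1 / (344 * (H : ℝ) ^ 2) ≤ 1 := by
    rw [div_le_iff₀ (by positivity)]; nlinarith
  have hδκ : δ ≤ 1 / (344 * (H : ℝ) ^ 2) / 4 := by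
    rw [div_div, le_div_iff₀ (by positivity)]; nlinarith
  exact quadForm_le_two_mul_twoFormMinus (posDef_kronecker_one (hodgeQ H) (hodgeQ_posDef H)) hκ (hodgeKron_coercive hH) hδ0 hδκ x

/-- The MINUS precision `(2β)·((1−δ)(hodgeQ ⊗ₖ 1₃) − δ·1)` is positive definite (`β > 0`, `1376H²δ ≤ 1`). -/
theorem posDef_precMinus (hH : 1 ≤ H) {β δ : ℝ} (hβ : 0 < β) (hδ0 : 0 ≤ δ) (hδ : 1376 * (H : ℝ) ^ 2 * δ ≤ 1) :
    ((2 * β) • ((1 - δ) • (hodgeQ H ⊗ₖ (1 : Matrix (Fin 3) (Fin 3) ℝ)) -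
      δ • (1 : Matrix (LandauFree H × Fin 3) (LandauFree H × Fin 3) ℝ))).PosDef := by
  have hA := posDef_kronecker_one (hodgeQ H) (hodgeQ_posDef H) (o := Fin 3)
  have hM : ((1 - δ) • (hodgeQ H ⊗ₖ (1 : Matrix (Fin 3) (Fin 3) ℝ)) -
      δ • (1 : Matrix (LandauFree H × Fin 3) (LandauFree H × Fin 3) ℝ)).PosDef := by
    refine Matrix.PosDef.of_dotProduct_mulVec_pos ?_ fun x hx => ?_
    · rw [twoFormMinus_eq_add]; exact isHermitian_twoForm _ _
    · have h1 := quadForm_le_two_mul_minus hH hδ0 hδ x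
      have h2 := hA.dotProduct_mulVec_pos hx
      rw [star_trivial] at h2 ⊢
      linarith
  exact hM.smul (by positivity)

/-- The PLUS precision `(2β)·((1+δ)(hodgeQ ⊗ₖ 1₃) + δ·1)` is positive definite (`β > 0`, `δ ≥ 0`). -/
theorem posDef_precPlus {β δ : ℝ} (hβ : 0 < β) (hδ0 : 0 ≤ δ) :
    ((2 * β) • ((1 + δ) • (hodgeQ H ⊗ₖ (1 : Matrix (Fin 3) (Fin 3) ℝ)) +
      δ • (1 : Matrix (LandauFree H × Fin 3) (LandauFree H × Fin 3) ℝ))).PosDef := by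
  have hA := posDef_kronecker_one (hodgeQ H) (hodgeQ_posDef H) (o := Fin 3)
  have hM : ((1 + δ) • (hodgeQ H ⊗ₖ (1 : Matrix (Fin 3) (Fin 3) ℝ)) +
      δ • (1 : Matrix (LandauFree H × Fin 3) (LandauFree H × Fin 3) ℝ)).PosDef := by
    refine Matrix.PosDef.of_dotProduct_mulVec_pos (isHermitian_twoForm _ _) fun x hx => ?_
    have h1 := quadForm_le_twoFormPlus hA hδ0 x
    have h2 := hA.dotProduct_mulVec_pos hx
    rw [star_trivial] at h2 ⊢
    linarith
  exact hM.smul (by positivity)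

/-! ## Masses and the mass ratio -/

/-- The chart integral of a two-form Gaussian is the flat Gaussian integral (MINUS form). -/
theorem integral_exp_twoFormMinus_eq (hH : 1 ≤ H) {β δ : ℝ} (hβ : 0 < β) (hδ0 : 0 ≤ δ) (hδ : 1376 * (H : ℝ) ^ 2 * δ ≤ 1) :
    ∫ a : LandauFree H → E3, Real.exp (-(β * ((1 - δ) * boxQuadForm H a - δ * ∑ e, ‖a e‖ ^ 2))) =
      Real.sqrt (2 * Real.pi) ^ Fintype.card (LandauFree H × Fin 3) /
        Real.sqrt ((2 * β) • ((1 - δ) • (hodgeQ H ⊗ₖ (1 : Matrix (Fin 3) (Fin 3) ℝ)) -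
          δ • (1 : Matrix (LandauFree H × Fin 3) (LandauFree H × Fin 3) ℝ))).det := by
  rw [← Literature.MathematicalPhysics.QuantumFieldTheory.Balaban1983to89.Beta.GaussianIntegral.integral_exp_neg_half_quadForm _
    (posDef_precMinus hH hβ hδ0 hδ), ← (volume_preserving_flatten (LandauFree H)).integral_comp (flatten (LandauFree H)).measurableEmbedding]
  refine integral_congr_ae (ae_of_all _ fun a => ?_)
  simp only [neg_twoFormMinus_eq]

/-- The chart integral of a two-form Gaussian is the flat Gaussian integral (PLUS form). -/
theorem integral_exp_twoFormPlus_eq {β δ : ℝ} (hβ : 0 < β) (hδ0 : 0 ≤ δ) :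
    ∫ a : LandauFree H → E3, Real.exp (-(β * ((1 + δ) * boxQuadForm H a + δ * ∑ e, ‖a e‖ ^ 2))) =
      Real.sqrt (2 * Real.pi) ^ Fintype.card (LandauFree H × Fin 3) /
        Real.sqrt ((2 * β) • ((1 + δ) • (hodgeQ H ⊗ₖ (1 : Matrix (Fin 3) (Fin 3) ℝ)) +
          δ • (1 : Matrix (LandauFree H × Fin 3) (LandauFree H × Fin 3) ℝ))).det := by
  rw [← Literature.MathematicalPhysics.QuantumFieldTheory.Balaban1983to89.Beta.GaussianIntegral.integral_exp_neg_half_quadForm _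
    (posDef_precPlus (H := H) hβ hδ0), ← (volume_preserving_flatten (LandauFree H)).integral_comp (flatten (LandauFree H)).measurableEmbedding]
  refine integral_congr_ae (ae_of_all _ fun a => ?_)
  simp only [neg_twoFormPlus_eq]

/-- Integrability of the two-form Gaussians. -/
theorem integrable_exp_twoFormMinus (hH : 1 ≤ H) {β δ : ℝ} (hβ : 0 < β) (hδ0 : 0 ≤ δ) (hδ : 1376 * (H : ℝ) ^ 2 * δ ≤ 1) :
    Integrable fun a : LandauFree H → E3 => Real.exp (-(β * ((1 - δ) * boxQuadForm H a - δ * ∑ e, ‖a e‖ ^ 2))) := by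
  have hfi := Literature.MathematicalPhysics.QuantumFieldTheory.Balaban1983to89.Beta.GaussianIntegral.integrable_exp_neg_half_quadForm _
    (posDef_precMinus hH hβ hδ0 hδ)
  have h := ((volume_preserving_flatten (LandauFree H)).integrable_comp_emb (flatten (LandauFree H)).measurableEmbedding).2 hfi
  refine h.congr (ae_of_all _ fun a => ?_)
  simp only [Function.comp_apply, neg_twoFormMinus_eq]

/-- Integrability of the two-form Gaussians (PLUS). -/
theorem integrable_exp_twoFormPlus {β δ : ℝ} (hβ : 0 < β) (hδ0 : 0 ≤ δ) :
    Integrable fun a : LandauFree H → E3 => Real.exp (-(β * ((1 + δ) * boxQuadForm H a + δ * ∑ e, ‖a e‖ ^ 2))) := by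
  have hfi := Literature.MathematicalPhysics.QuantumFieldTheory.Balaban1983to89.Beta.GaussianIntegral.integrable_exp_neg_half_quadForm _
    (posDef_precPlus (H := H) hβ hδ0)
  have h := ((volume_preserving_flatten (LandauFree H)).integrable_comp_emb (flatten (LandauFree H)).measurableEmbedding).2 hfi
  refine h.congr (ae_of_all _ fun a => ?_)
  simp only [Function.comp_apply, neg_twoFormPlus_eq]

/-- Positivity of the PLUS mass. -/
theorem integral_exp_twoFormPlus_pos {β δ : ℝ} (hβ : 0 < β) (hδ0 : 0 ≤ δ) :
    0 < ∫ a : LandauFree H → E3, Real.exp (-(β * ((1 + δ) * boxQuadForm H a + δ * ∑ e, ‖a e‖ ^ 2))) := by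
  rw [integral_exp_twoFormPlus_eq hβ hδ0]
  exact div_pos (pow_pos (Real.sqrt_pos.2 (by positivity)) _) (Real.sqrt_pos.2 (posDef_precPlus (H := H) hβ hδ0).det_pos)

/-- Arithmetic of the exponent (opaque reals): `N = 3n`, `tr ≤ 3C₃n` ⇒ `3δN + 5δ·tr ≤ (9 + 15C₃)·δ·n`. -/
theorem ratio_exponent_aux {n N δ C₃ tr : ℝ} (hN : N = 3 * n) (hδ : 0 ≤ δ) (htr : tr ≤ 3 * C₃ * n) :
    3 * δ * N + 5 * δ * tr ≤ (9 + 15 * C₃) * δ * n := by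
  rw [hN]
  nlinarith [mul_le_mul_of_nonneg_left htr (by positivity : (0:ℝ) ≤ 5 * δ)]

/-- Arithmetic of the ratio (opaque reals): `b ≤ e·a`, all positive ⇒ `S/a ≤ e·(S/b)`. -/
theorem ratio_div_aux {S a b e : ℝ} (hS : 0 ≤ S) (ha : 0 < a) (hb : 0 < b) (hsq : b ≤ e * a) : S / a ≤ e * (S / b) := by
  rw [div_le_iff₀ ha]
  have h1 : S * b ≤ S * (e * a) := mul_le_mul_of_nonneg_left hsq hS
  have h2 : e * (S / b) * a = S * (e * a) / b := by field_simp
  rw [h2, le_div_iff₀ hb]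
  exact h1

/-- ★ **The mass ratio of the two-form Gaussians**: `∫ e^{−β((1−δ)Q − δN)} ≤ exp(((9 + 15C₃)/2)·δ·n) · ∫ e^{−β((1+δ)Q + δN)}`
(`n = |LandauFree H|`, `1376H²δ ≤ 1`, variance bound `(hodgeQ⁻¹)_{ee} ≤ C₃`). -/
theorem integral_exp_twoFormMinus_le (hH : 1 ≤ H) {β δ C₃ : ℝ} (hβ : 0 < β) (hδ0 : 0 ≤ δ) (hδ : 1376 * (H : ℝ) ^ 2 * δ ≤ 1)
    (hvar : ∀ e : LandauFree H, (hodgeQ H)⁻¹ e e ≤ C₃) :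
    ∫ a : LandauFree H → E3, Real.exp (-(β * ((1 - δ) * boxQuadForm H a - δ * ∑ e, ‖a e‖ ^ 2))) ≤
      Real.exp ((9 + 15 * C₃) / 2 * δ * Fintype.card (LandauFree H)) *
        ∫ a : LandauFree H → E3, Real.exp (-(β * ((1 + δ) * boxQuadForm H a + δ * ∑ e, ‖a e‖ ^ 2))) := by
  have hH' : (1 : ℝ) ≤ H := by exact_mod_cast hH
  have hH2 : (1 : ℝ) ≤ (H : ℝ) ^ 2 := one_le_pow₀ hH'
  have hA := posDef_kronecker_one (hodgeQ H) (hodgeQ_posDef H) (o := Fin 3)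
  have hκ0 : 0 < 1 / (344 * (H : ℝ) ^ 2) := by positivity
  have hκ : 1 / (344 * (H : ℝ) ^ 2) ≤ 1 := by rw [div_le_iff₀ (by positivity)]; nlinarith
  have hδκ : δ ≤ 1 / (344 * (H : ℝ) ^ 2) / 4 := by rw [div_div, le_div_iff₀ (by positivity)]; nlinarith
  obtain ⟨hmpos, hdet⟩ := det_twoForm_le hA hκ0 hκ (hodgeKron_coercive hH) hδ0 hδκ
  have hPp := posDef_precPlus (H := H) hβ hδ0
  rw [integral_exp_twoFormMinus_eq hH hβ hδ0 hδ, integral_exp_twoFormPlus_eq hβ hδ0, det_smul, det_smul]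
  -- the exponent: `3δN + 5δ·tr ≤ (9 + 15C₃)·δ·n`
  have htr := trace_hodgeKron_inv_le (H := H) hvar
  have hNn : ((Fintype.card (LandauFree H × Fin 3) : ℕ) : ℝ) = 3 * (Fintype.card (LandauFree H) : ℝ) := by
    rw [Fintype.card_prod, Fintype.card_fin]; push_cast; ring
  have hE := ratio_exponent_aux hNn hδ0 htr
  have hdet' := hdet.trans (mul_le_mul_of_nonneg_right (Real.exp_le_exp.2 hE) hmpos.le)
  -- square roots
  have h2β : 0 < (2 * β) ^ Fintype.card (LandauFree H × Fin 3) := pow_pos (by positivity) _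
  have hDm : 0 < Real.sqrt ((2 * β) ^ Fintype.card (LandauFree H × Fin 3) *
      ((1 - δ) • (hodgeQ H ⊗ₖ (1 : Matrix (Fin 3) (Fin 3) ℝ)) - δ • (1 : Matrix (LandauFree H × Fin 3) (LandauFree H × Fin 3) ℝ)).det) :=
    Real.sqrt_pos.2 (mul_pos h2β hmpos)
  have hDp : 0 < Real.sqrt ((2 * β) ^ Fintype.card (LandauFree H × Fin 3) *
      ((1 + δ) • (hodgeQ H ⊗ₖ (1 : Matrix (Fin 3) (Fin 3) ℝ)) + δ • (1 : Matrix (LandauFree H × Fin 3) (LandauFree H × Fin 3) ℝ)).det) := by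
    have h := hPp.det_pos
    rw [det_smul] at h
    exact Real.sqrt_pos.2 h
  have hsq : Real.sqrt ((2 * β) ^ Fintype.card (LandauFree H × Fin 3) *
      ((1 + δ) • (hodgeQ H ⊗ₖ (1 : Matrix (Fin 3) (Fin 3) ℝ)) + δ • (1 : Matrix (LandauFree H × Fin 3) (LandauFree H × Fin 3) ℝ)).det) ≤
      Real.exp ((9 + 15 * C₃) / 2 * δ * Fintype.card (LandauFree H)) *
        Real.sqrt ((2 * β) ^ Fintype.card (LandauFree H × Fin 3) *
          ((1 - δ) • (hodgeQ H ⊗ₖ (1 : Matrix (Fin 3) (Fin 3) ℝ)) - δ • (1 : Matrix (LandauFree H × Fin 3) (LandauFree H × Fin 3) ℝ)).det) := by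
    refine (Real.sqrt_le_sqrt (mul_le_mul_of_nonneg_left hdet' h2β.le)).trans (le_of_eq ?_)
    have hsqrt : Real.sqrt (Real.exp ((9 + 15 * C₃) * δ * (Fintype.card (LandauFree H) : ℝ))) =
        Real.exp ((9 + 15 * C₃) / 2 * δ * (Fintype.card (LandauFree H) : ℝ)) := by
      rw [show Real.exp ((9 + 15 * C₃) * δ * (Fintype.card (LandauFree H) : ℝ)) =
          Real.exp ((9 + 15 * C₃) / 2 * δ * (Fintype.card (LandauFree H) : ℝ)) ^ 2 by rw [← Real.exp_nat_mul]; ring_nf,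
        Real.sqrt_sq (Real.exp_pos _).le]
    rw [mul_left_comm, Real.sqrt_mul (Real.exp_pos _).le, hsqrt]
  exact ratio_div_aux (pow_nonneg (Real.sqrt_nonneg _) _) hDm hDp hsq

/-! ## Generic flat-precision tools: transport, tail, box mass -/

/-- Transport: a chart integrand `f(a) = e^{−½ ♭aᵀP♭a}` integrates over all of `LandauFree H → E3` to the flat Gaussian mass of `P`. -/
theorem integral_eq_flat_of {P : Matrix (LandauFree H × Fin 3) (LandauFree H × Fin 3) ℝ} (hP : P.PosDef)
    {f : (LandauFree H → E3) → ℝ} (hf : ∀ a, f a = Real.exp (-(1/2 : ℝ) * (flatten (LandauFree H) a ⬝ᵥ (P *ᵥ flatten (LandauFree H) a)))) :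
    ∫ a, f a = Real.sqrt (2 * Real.pi) ^ Fintype.card (LandauFree H × Fin 3) / Real.sqrt P.det := by
  rw [← Literature.MathematicalPhysics.QuantumFieldTheory.Balaban1983to89.Beta.GaussianIntegral.integral_exp_neg_half_quadForm _ hP,
    ← (volume_preserving_flatten (LandauFree H)).integral_comp (flatten (LandauFree H)).measurableEmbedding]
  exact integral_congr_ae (ae_of_all _ fun a => hf a)

/-- Transport of the TAIL: the chart integral off the small-field box is at most the flat Gaussian integral over the coordinate tail set. -/
theorem setIntegral_compl_smallField_le_flat_of {P : Matrix (LandauFree H × Fin 3) (LandauFree H × Fin 3) ℝ} (hP : P.PosDef)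
    {f : (LandauFree H → E3) → ℝ} (hf : ∀ a, f a = Real.exp (-(1/2 : ℝ) * (flatten (LandauFree H) a ⬝ᵥ (P *ᵥ flatten (LandauFree H) a))))
    (s : ℝ) :
    ∫ a in (smallField H s)ᶜ, f a ≤
      ∫ v in {v : LandauFree H × Fin 3 → ℝ | ∃ p, s / Real.sqrt 3 ≤ |v p|}, Real.exp (-(1/2 : ℝ) * (v ⬝ᵥ P *ᵥ v)) := by
  have hmeasT : MeasurableSet {v : LandauFree H × Fin 3 → ℝ | ∃ p, s / Real.sqrt 3 ≤ |v p|} :=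
    measurableSet_exists_coord_tail (s / Real.sqrt 3)
  have hfi := Literature.MathematicalPhysics.QuantumFieldTheory.Balaban1983to89.Beta.GaussianIntegral.integrable_exp_neg_half_quadForm _ hP
  rw [← integral_indicator (measurableSet_smallField s).compl, ← integral_indicator hmeasT,
    ← (volume_preserving_flatten (LandauFree H)).integral_comp (flatten (LandauFree H)).measurableEmbedding]
  have hint := ((volume_preserving_flatten (LandauFree H)).integrable_comp_emb (flatten (LandauFree H)).measurableEmbedding).2
    (hfi.indicator hmeasT)
  refine integral_mono_of_nonneg (ae_of_all _ fun a => Set.indicator_nonneg (fun _ _ => by rw [hf]; exact (Real.exp_pos _).le) _) hint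
    (ae_of_all _ fun a => ?_)
  show (smallField H s)ᶜ.indicator f a ≤
    {v : LandauFree H × Fin 3 → ℝ | ∃ p, s / Real.sqrt 3 ≤ |v p|}.indicator
      (fun v => Real.exp (-(1/2 : ℝ) * (v ⬝ᵥ P *ᵥ v))) (flatten (LandauFree H) a)
  by_cases ha : a ∈ (smallField H s)ᶜ
  · have hmem : flatten (LandauFree H) a ∈ {v : LandauFree H × Fin 3 → ℝ | ∃ p, s / Real.sqrt 3 ≤ |v p|} :=
      exists_coord_of_not_smallField ha
    rw [Set.indicator_of_mem ha, Set.indicator_of_mem hmem, hf]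
  · rw [Set.indicator_of_notMem ha]
    exact Set.indicator_nonneg (fun _ _ => (Real.exp_pos _).le) _

/-- **Generic relative tail**: with coordinate variances `P⁻¹_pp ≤ (2β′)⁻¹·C₃`, `∫_{a ∉ smallField s} f ≤ 6n·e^{−β′s²/(3C₃)}·∫ f`. -/
theorem setIntegral_compl_smallField_le_of {P : Matrix (LandauFree H × Fin 3) (LandauFree H × Fin 3) ℝ} (hP : P.PosDef)
    {f : (LandauFree H → E3) → ℝ} (hf : ∀ a, f a = Real.exp (-(1/2 : ℝ) * (flatten (LandauFree H) a ⬝ᵥ (P *ᵥ flatten (LandauFree H) a))))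
    {β' s C₃ : ℝ} (hβ' : 0 < β') (hs : 0 ≤ s) (hC₃ : 0 < C₃) (hdiag : ∀ p, P⁻¹ p p ≤ (2 * β')⁻¹ * C₃) :
    ∫ a in (smallField H s)ᶜ, f a ≤ 6 * Fintype.card (LandauFree H) * Real.exp (-(β' * s ^ 2 / (3 * C₃))) * ∫ a, f a := by
  have h1 := setIntegral_compl_smallField_le_flat_of hP hf s
  have hρ : 0 ≤ s / Real.sqrt 3 := div_nonneg hs (Real.sqrt_nonneg _)
  have h2 := setIntegral_exists_coord_tail_le hP hρ
  have h3 : ∑ p : LandauFree H × Fin 3, Real.exp (-((s / Real.sqrt 3) ^ 2 / (2 * P⁻¹ p p))) ≤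
      3 * Fintype.card (LandauFree H) * Real.exp (-(β' * s ^ 2 / (3 * C₃))) := by
    calc ∑ p : LandauFree H × Fin 3, Real.exp (-((s / Real.sqrt 3) ^ 2 / (2 * P⁻¹ p p)))
        ≤ ∑ _p : LandauFree H × Fin 3, Real.exp (-(β' * s ^ 2 / (3 * C₃))) :=
          Finset.sum_le_sum fun p _ => exp_coord_tail_le hβ' hC₃ (hP.inv.diag_pos (i := p)) (hdiag p)
      _ = 3 * Fintype.card (LandauFree H) * Real.exp (-(β' * s ^ 2 / (3 * C₃))) := by
          rw [Finset.sum_const, Finset.card_univ, nsmul_eq_mul, Fintype.card_prod, Fintype.card_fin]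
          push_cast
          ring
  have hZ : 0 ≤ Real.sqrt (2 * Real.pi) ^ Fintype.card (LandauFree H × Fin 3) / Real.sqrt P.det :=
    div_nonneg (pow_nonneg (Real.sqrt_nonneg _) _) (Real.sqrt_nonneg _)
  rw [integral_eq_flat_of hP hf]
  refine h1.trans (h2.trans ?_)
  have h4 := mul_le_mul_of_nonneg_right (mul_le_mul_of_nonneg_left h3 (by norm_num : (0:ℝ) ≤ 2)) hZ
  refine h4.trans (le_of_eq ?_)
  ring

/-- **Generic box mass from below**: `(1 − 6n·e^{−β′t²/(3C₃)})·∫ f ≤ ∫_{smallField t} f`. -/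
theorem le_setIntegral_smallField_of {P : Matrix (LandauFree H × Fin 3) (LandauFree H × Fin 3) ℝ} (hP : P.PosDef)
    {f : (LandauFree H → E3) → ℝ} (hf : ∀ a, f a = Real.exp (-(1/2 : ℝ) * (flatten (LandauFree H) a ⬝ᵥ (P *ᵥ flatten (LandauFree H) a))))
    (hfi : Integrable f) {β' t C₃ : ℝ} (hβ' : 0 < β') (ht : 0 ≤ t) (hC₃ : 0 < C₃) (hdiag : ∀ p, P⁻¹ p p ≤ (2 * β')⁻¹ * C₃) :
    (1 - 6 * Fintype.card (LandauFree H) * Real.exp (-(β' * t ^ 2 / (3 * C₃)))) * ∫ a, f a ≤ ∫ a in smallField H t, f a := by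
  have htail := setIntegral_compl_smallField_le_of hP hf hβ' ht hC₃ hdiag
  have hsplit := integral_add_compl (measurableSet_smallField (H := H) t) hfi
  rw [sub_mul, one_mul]
  linarith

/-! ## Coordinate variances of the two precisions -/

/-- **MINUS variances**: `(P₋⁻¹)_pp ≤ (2·(β/2))⁻¹·C₃` (`P₋ = (2β)((1−δ)A − δ·1) ≥ (2·(β/2))·A` as forms when `1376H²δ ≤ 1`). -/
theorem precMinus_inv_diag_le (hH : 1 ≤ H) {β δ C₃ : ℝ} (hβ : 0 < β) (hδ0 : 0 ≤ δ) (hδ : 1376 * (H : ℝ) ^ 2 * δ ≤ 1)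
    (hvar : ∀ e : LandauFree H, (hodgeQ H)⁻¹ e e ≤ C₃) (p : LandauFree H × Fin 3) :
    ((2 * β) • ((1 - δ) • (hodgeQ H ⊗ₖ (1 : Matrix (Fin 3) (Fin 3) ℝ)) -
      δ • (1 : Matrix (LandauFree H × Fin 3) (LandauFree H × Fin 3) ℝ)))⁻¹ p p ≤ (2 * (β / 2))⁻¹ * C₃ := by
  have hβ2 : 0 < β / 2 := by positivity
  have hM' := posDef_precision (H := H) hβ2
  have hM := posDef_precMinus hH hβ hδ0 hδ
  have hle : ∀ x : LandauFree H × Fin 3 → ℝ,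
      x ⬝ᵥ (((2 * (β / 2)) • (hodgeQ H ⊗ₖ (1 : Matrix (Fin 3) (Fin 3) ℝ))) *ᵥ x) ≤
        x ⬝ᵥ (((2 * β) • ((1 - δ) • (hodgeQ H ⊗ₖ (1 : Matrix (Fin 3) (Fin 3) ℝ)) -
          δ • (1 : Matrix (LandauFree H × Fin 3) (LandauFree H × Fin 3) ℝ))) *ᵥ x) := by
    intro x
    have h := quadForm_le_two_mul_minus hH hδ0 hδ x
    rw [Matrix.smul_mulVec, dotProduct_smul, Matrix.smul_mulVec, dotProduct_smul, smul_eq_mul, smul_eq_mul]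
    nlinarith
  have h := inv_diag_le_of_quadForm_le hM hM' hle p
  rw [precision_inv_diag hβ2] at h
  exact h.trans (mul_le_mul_of_nonneg_left (hvar p.1) (by positivity))

/-- **PLUS variances**: `(P₊⁻¹)_pp ≤ (2β)⁻¹·C₃` (`P₊ ≥ (2β)·A`). -/
theorem precPlus_inv_diag_le {β δ C₃ : ℝ} (hβ : 0 < β) (hδ0 : 0 ≤ δ)
    (hvar : ∀ e : LandauFree H, (hodgeQ H)⁻¹ e e ≤ C₃) (p : LandauFree H × Fin 3) :
    ((2 * β) • ((1 + δ) • (hodgeQ H ⊗ₖ (1 : Matrix (Fin 3) (Fin 3) ℝ)) +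
      δ • (1 : Matrix (LandauFree H × Fin 3) (LandauFree H × Fin 3) ℝ)))⁻¹ p p ≤ (2 * β)⁻¹ * C₃ := by
  have hA := posDef_kronecker_one (hodgeQ H) (hodgeQ_posDef H) (o := Fin 3)
  have hM' := posDef_precision (H := H) hβ
  have hM := posDef_precPlus (H := H) (δ := δ) hβ hδ0
  have hle : ∀ x : LandauFree H × Fin 3 → ℝ,
      x ⬝ᵥ (((2 * β) • (hodgeQ H ⊗ₖ (1 : Matrix (Fin 3) (Fin 3) ℝ))) *ᵥ x) ≤
        x ⬝ᵥ (((2 * β) • ((1 + δ) • (hodgeQ H ⊗ₖ (1 : Matrix (Fin 3) (Fin 3) ℝ)) +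
          δ • (1 : Matrix (LandauFree H × Fin 3) (LandauFree H × Fin 3) ℝ))) *ᵥ x) := by
    intro x
    have h := quadForm_le_twoFormPlus hA hδ0 x
    rw [Matrix.smul_mulVec, dotProduct_smul, Matrix.smul_mulVec, dotProduct_smul, smul_eq_mul, smul_eq_mul]
    exact mul_le_mul_of_nonneg_left h (by positivity)
  have h := inv_diag_le_of_quadForm_le hM hM' hle p
  rw [precision_inv_diag hβ] at h
  exact h.trans (mul_le_mul_of_nonneg_left (hvar p.1) (by positivity))

/-! ## Tails and box masses of the two-form Gaussians -/

/-- ★ **Tail of the MINUS Gaussian**: `∫_{a ∉ smallField s} e^{−β((1−δ)Q − δN)} ≤ 6n·e^{−(β/2)s²/(3C₃)} · ∫ e^{−β((1−δ)Q − δN)}`. -/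
theorem setIntegral_compl_smallField_twoFormMinus_le (hH : 1 ≤ H) {β δ s C₃ : ℝ} (hβ : 0 < β) (hδ0 : 0 ≤ δ)
    (hδ : 1376 * (H : ℝ) ^ 2 * δ ≤ 1) (hs : 0 ≤ s) (hC₃ : 0 < C₃) (hvar : ∀ e : LandauFree H, (hodgeQ H)⁻¹ e e ≤ C₃) :
    ∫ a in (smallField H s)ᶜ, Real.exp (-(β * ((1 - δ) * boxQuadForm H a - δ * ∑ e, ‖a e‖ ^ 2))) ≤
      6 * Fintype.card (LandauFree H) * Real.exp (-(β / 2 * s ^ 2 / (3 * C₃))) *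
        ∫ a : LandauFree H → E3, Real.exp (-(β * ((1 - δ) * boxQuadForm H a - δ * ∑ e, ‖a e‖ ^ 2))) :=
  setIntegral_compl_smallField_le_of (posDef_precMinus hH hβ hδ0 hδ) (fun a => by rw [neg_twoFormMinus_eq]) (by positivity) hs hC₃
    (precMinus_inv_diag_le hH hβ hδ0 hδ hvar)

/-- ★ **Box mass of the PLUS Gaussian**: `(1 − 6n·e^{−βt²/(3C₃)}) · ∫ e^{−β((1+δ)Q + δN)} ≤ ∫_{smallField t} e^{−β((1+δ)Q + δN)}`. -/
theorem le_setIntegral_smallField_twoFormPlus {β δ t C₃ : ℝ} (hβ : 0 < β) (hδ0 : 0 ≤ δ) (ht : 0 ≤ t) (hC₃ : 0 < C₃)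
    (hvar : ∀ e : LandauFree H, (hodgeQ H)⁻¹ e e ≤ C₃) :
    (1 - 6 * Fintype.card (LandauFree H) * Real.exp (-(β * t ^ 2 / (3 * C₃)))) *
        ∫ a : LandauFree H → E3, Real.exp (-(β * ((1 + δ) * boxQuadForm H a + δ * ∑ e, ‖a e‖ ^ 2))) ≤
      ∫ a in smallField H t, Real.exp (-(β * ((1 + δ) * boxQuadForm H a + δ * ∑ e, ‖a e‖ ^ 2))) :=
  le_setIntegral_smallField_of (posDef_precPlus (H := H) hβ hδ0) (fun a => by rw [neg_twoFormPlus_eq]) (integrable_exp_twoFormPlus hβ hδ0)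
    hβ ht hC₃ (precPlus_inv_diag_le hβ hδ0 hvar)

end TwoFormGauss

end Summit.QuantumFields.YangMills.Theorems.AllWindowsColdBoxBoxHighLine
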